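import Mathlib
import HarnessLib
import Literature.MathematicalPhysics.QuantumLattice.HubbardTwoPointMoments
import Literature.MathematicalPhysics.QuantumLattice.HubbardEffectiveActionCT
import Literature.MathematicalPhysics.QuantumLattice.GrassmannLaplacianPairWick

/-!
# Child 4 `KLRegimeTwoPointAssembly` of crux K3 (stmt-HubbardSuperconductivity-19637) — the objects of its skeleton
# `Lines/asm-repr` (lead hubbard-kl-r2d-p2): bare / countertermed Grassmann two-point ratios, the fully integrated
# countertermed action, and the representation `R^K_{L,M}`

Definitions with bodies only (finite `(β, L, M)`, no claim about the model):

* `twoPointInsertion L M β σ σ' x̄ ȳ = ψ⁺_{(x̄,0)σ} ψ⁻_{(ȳ,0)σ'}` (the tree's `positionField` at imaginary time `0`);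
* `grassmannRatio` — `∫dμ_{C_M} ψ⁺ψ⁻ e^{−V} / ∫dμ_{C_M} e^{−V}` at covariance chemical potential `μ`, the object of the tree's
  `tendsto_grassmannTwoPoint_eq_hubbardThermalTwoPoint_sub` (BGM 2006 §2.1 (2.8)); `grassmannRatioCT` — the same in the
  counterterm frame `K` (`hubbardCovarianceCT`, `hubbardInteractionCT`);
* `fullActionCT L M β U μ K = effAction ℂ C^K V_K` — the FULLY INTEGRATED countertermed effective action
  (`= hubbardEffectiveActionCT L M β U μ 0 K Λ` for every `0 < Λ ≤ π/β`, `hubbardEffectiveActionCT_eq_of_le`);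
* `fieldCoeff` — the coefficient `(βL²)⁻¹ conj e^{-is_c k·(ȳ,0)}` of `ψ̂^c_{kσ}` in `ψ^c_{(ȳ,0)σ}` (BGM (2.5));
* `twoPointReprCT` — `R^K_{L,M} = Σ_{k,k'} a_k b_{k'} [A_K(X_k,Y_{k'}) + Σ_{Y,Z} A_K(X_k,Y) A_K(Y_{k'},Z) constPart(∂_Z∂_Y 𝒢^K)]`,
  `A_K = contr C^K`: free CT two-point function of the two position fields plus the `C^K`-dressed two-leg coefficient of
  `𝒢^K` — what the bare ratio equals once `M` is large (stubs `stub_asm_frame`, `stub_asm_repr` of the skeleton);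
* `halfDelta σ σ' x y = ½[σ = σ'][x = y]` — the infinite-volume midpoint correction.

References: G. Benfatto, A. Giuliani, V. Mastropietro, Ann. Henri Poincaré 7 (2006) 809, §2.1 (2.5)–(2.8), §2.4;
HOME/STATUS (cell gate-hubbard-kl) hubbard-kl-r2d-p2 lines of 2026-08-26.
-/

noncomputable section

namespace Summit.HubbardSuperconductivity.HubbardSuperconductivity.Theorems.TwoPointAssembly

set_option linter.dupNamespace false -- summit = problem name (single-conjunct summit), D-0017

open Literature.MathematicalPhysics.QuantumLattice Literature.Probability.LatticeModels GrassmannAlgebra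

section Objects

variable (L M : ℕ) [NeZero L]

/-- The bare two-point insertion `ψ⁺_{(x̄,0)σ} ψ⁻_{(ȳ,0)σ'}` (position–time fields at imaginary time `0`). -/
def twoPointInsertion (β : ℝ) (σ σ' : Fin 2) (xe ye : TorusSite 2 L) : HubbardGrassmann L M :=
  positionField L M β 0 σ xe 0 * positionField L M β 1 σ' ye 0

/-- **The bare Grassmann two-point ratio at Matsubara cutoff `M`**:
`∫dμ_{C_M} ψ⁺_{(x̄,0)σ}ψ⁻_{(ȳ,0)σ'} e^{−V} / ∫dμ_{C_M} e^{−V}` at covariance chemical potential `μ`. -/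
def grassmannRatio (β U μ : ℝ) (σ σ' : Fin 2) (xe ye : TorusSite 2 L) : ℂ :=
  gaussExpect ℂ (hubbardCovariance L M β μ 0) (twoPointInsertion L M β σ σ' xe ye * grassmannExp (-(hubbardInteraction L M β U))) /
    effPartitionFn ℂ (hubbardCovariance L M β μ 0) (hubbardInteraction L M β U)

/-- The same ratio computed in the counterterm frame `K` (covariance `C^K`, interaction `V_K = V + 𝒩_K`). -/
def grassmannRatioCT (β U μ : ℝ) (K : TrigPolyC4v) (σ σ' : Fin 2) (xe ye : TorusSite 2 L) : ℂ :=
  gaussExpect ℂ (hubbardCovarianceCT L M β μ 0 K)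
      (twoPointInsertion L M β σ σ' xe ye * grassmannExp (-(hubbardInteractionCT L M β U K))) /
    effPartitionFn ℂ (hubbardCovarianceCT L M β μ 0 K) (hubbardInteractionCT L M β U K)

/-- **The fully integrated countertermed effective action** `𝒢^K = effAction C^K V_K`. -/
def fullActionCT (β U μ : ℝ) (K : TrigPolyC4v) : HubbardGrassmann L M :=
  effAction ℂ (hubbardCovarianceCT L M β μ 0 K) (hubbardInteractionCT L M β U K)

/-- The coefficient of `ψ̂^c_{kσ}` in the position–time field `ψ^c_{(ȳ,0)σ}` (BGM (2.5)). -/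
def fieldCoeff (β : ℝ) (c : Fin 2) (k : FreqMomentum L M) (ye : TorusSite 2 L) : ℂ :=
  (((1 / (β * (L : ℝ) ^ 2) : ℝ) : ℂ) * (starRingEnd ℂ) (vertexPlaneWave L M β c k ye 0))

/-- **The representation `R^K_{L,M}`** of the two-point ratio in the frame `K` (no division). -/
def twoPointReprCT (β U μ : ℝ) (K : TrigPolyC4v) (σ σ' : Fin 2) (xe ye : TorusSite 2 L) : ℂ :=
  ∑ k : FreqMomentum L M, ∑ k' : FreqMomentum L M,
    fieldCoeff L M β 0 k xe * fieldCoeff L M β 1 k' ye *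
      (contr ℂ (hubbardCovarianceCT L M β μ 0 K) (((k, σ), 0) : HubbardFieldIdx L M) ((k', σ'), 1) +
        ∑ Y : HubbardFieldIdx L M, ∑ Z : HubbardFieldIdx L M,
          contr ℂ (hubbardCovarianceCT L M β μ 0 K) (((k, σ), 0) : HubbardFieldIdx L M) Y *
            contr ℂ (hubbardCovarianceCT L M β μ 0 K) (((k', σ'), 1) : HubbardFieldIdx L M) Z *
              constPart ℂ (grassmannDeriv ℂ Z (grassmannDeriv ℂ Y (fullActionCT L M β U μ K))))

/-- The position–time field at time `0` as a linear combination of generators with the coefficients `fieldCoeff`. -/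
theorem positionField_zero_eq_sum (β : ℝ) (c σ : Fin 2) (ye : TorusSite 2 L) :
    positionField L M β c σ ye 0 =
      ∑ k : FreqMomentum L M, fieldCoeff L M β c k ye • gen ℂ (((k, σ), c) : HubbardFieldIdx L M) :=
  rfl

/-- In every frame the fully integrated action is the CT effective action at any scale `0 < Λ ≤ π/β`. -/
theorem fullActionCT_eq_hubbardEffectiveActionCT {β Λ : ℝ} (hβ : 0 < β) (hΛ : 0 < Λ) (hle : Λ ≤ Real.pi / β) (U μ : ℝ)
    (K : TrigPolyC4v) : fullActionCT L M β U μ K = hubbardEffectiveActionCT L M β U μ 0 K Λ := by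
  rw [fullActionCT, hubbardEffectiveActionCT_eq_of_le L M β U μ 0 K hβ hΛ hle]

end Objects

/-- The midpoint correction `½[σ = σ'][x = y]` in its infinite-volume form. -/
def halfDelta (σ σ' : Fin 2) (x y : Site 2) : ℂ := if σ = σ' ∧ x = y then (1 / 2 : ℂ) else 0

end Summit.HubbardSuperconductivity.HubbardSuperconductivity.Theorems.TwoPointAssembly

end
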